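import Summits.CriticalPhenomena.SAWScalingLimit.Theorems.SAWDevelopingMapHexTransferGMHexDictionary
import Summits.CriticalPhenomena.SAWScalingLimit.Theorems.ObservableToSLE.Negative.Identification
import HarnessLib

/-!
# `FaceLawHonest` (line `registered` = `birth` v3.3, crux `LatticeUniversality`,
# stmt-CriticalPhenomena-0807)

Sanity helper for the registered research stub `stub_hexMicroRobustAll` (the ∀-form merging clause
of the line `registered` for the crux
`Summit.CriticalPhenomena.SAWScalingLimit.Theses.SAWMassiveIsingTilt.LatticeUniversality`,
stmt-CriticalPhenomena-0807): **under its hypotheses the face-domain hexagonal law is an honest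
probability measure** (no junk-`0` corner coming from the Yang–Baxter weight `w₂(π/3) = 0`).

For a bounded domain `Ω`, a mesh `δ > 0` and distinct boundary mid-edges `a ≠ b` of the face set
`Ω_δ = meshFaces (π/3) Ω δ` joined by a Glazman–Manolescu walk `γ` of `Ω_δ`:

* the rhombi crossed by `γ` form a chain of side-adjacent rhombi of `Ω_δ` from `inclFace a` to
  `inclFace b` (`reachable_fc`, `fc_last_eq`), so the triangle `bdryVertex b` lies in the face
  component of `a` and is joined to `bdryVertex a` in the mesh vertex graph of the face domain
  (`embMeshVertexGraph_reachable_of_walk`), hence in its canonical hexagonal discretisation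
  `(faceDomain Ω δ a)_δ` (the discrete domain is the whole mesh vertex set,
  `embMeshDomain_faceDomain_eq`);
* the face domain is bounded: it is the image under the affine similarity `S_δ⁻¹ w = -i w + δ/2`
  of a subset of `Ω` (every rhombus of the face component is a rhombus of `Ω_δ`, i.e. its rescaled
  closed rhombus lies in `Ω`);
* so the critical hexagonal law of the face domain between the two boundary vertices is a
  probability measure (`isProbabilityMeasure_hexSAWLaw_of_reachable`: finitely many SAWs, one of
  positive weight), and so is its push-forward, the critical Yang–Baxter law of `Ω_δ` at `Θ ≡ π/3`
  (`map_hexSAWLaw_eq_ybLaw`).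

The eventual form along `δ → 0⁺` in the rotated, half-shifted domains `S_δ(D) = σD − iδ/2` is the
instance used by the skeleton. Elementary; tagged [folklore].
-/

noncomputable section

namespace Summit.CriticalPhenomena.SAWScalingLimit.Cruxes.LatticeUniversality.Birth

open MeasureTheory Filter Topology Set
open Complex (I I_ne_zero)
open Literature.Probability.RandomPlanarGeometry
open Literature.Probability.RandomPlanarGeometry.SAW
open Literature.Probability.RandomPlanarGeometry.SAW.YangBaxter
open Literature.Probability.LatticeModels (HexVertex hexGraph hexCenter)
open Summit.CriticalPhenomena.SAWScalingLimit.Cruxes.HexTransfer.YbRelay (third IsBdryEdge bdryVertex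
  faceDomain faceComp faceAdj inclFace gmFace faceUnion gmSimilarity gmSimilarity_symm_apply
  reachable_fc fc_last_eq gmFace_bdryVertex embMeshVertexGraph_reachable_of_walk
  embMeshDomain_faceDomain_eq map_hexSAWLaw_eq_ybLaw)
open Summit.CriticalPhenomena.SAWScalingLimit.Theorems.ObservableToSLE.Negative
  (isProbabilityMeasure_hexSAWLaw_of_reachable)

namespace FaceLawHonest

/-! ### The face domain is bounded -/

/-- The union of the rescaled closed rhombi of the face component of `Ω_δ` at `a` lies in `Ω`
(each of its rhombi is a rhombus of `Ω_δ = meshFaces (π/3) Ω δ`). [folklore] -/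
theorem faceUnion_meshFaces_subset (Ω : Set ℂ) (δ : ℝ) (a : MidEdge) :
    faceUnion (meshFaces third Ω δ) a δ ⊆ Ω := by
  intro z hz
  obtain ⟨g, hg, hz⟩ := mem_iUnion₂.1 hz
  obtain ⟨w, hw, rfl⟩ := hz
  exact (mem_meshFaces_iff.1 hg.1) w hw

/-- The inverse similarity `S_δ⁻¹ w = -i w + δ/2` maps bounded sets to bounded sets. [folklore] -/
theorem isBounded_image_gmSimilarity_symm (δ : ℝ) {s : Set ℂ} (hs : Bornology.IsBounded s) :
    Bornology.IsBounded ((gmSimilarity δ).symm '' s) := by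
  obtain ⟨R, hR⟩ := (Metric.isBounded_iff_subset_closedBall (0 : ℂ)).1 hs
  refine (Metric.isBounded_iff_subset_closedBall (0 : ℂ)).2 ⟨R + ‖(δ : ℂ) / 2‖, ?_⟩
  rintro _ ⟨w, hw, rfl⟩
  have hw' := hR hw
  rw [Metric.mem_closedBall, dist_zero_right] at hw' ⊢
  rw [gmSimilarity_symm_apply]
  calc ‖-I * w + (δ : ℂ) / 2‖ ≤ ‖-I * w‖ + ‖(δ : ℂ) / 2‖ := norm_add_le _ _
    _ = ‖w‖ + ‖(δ : ℂ) / 2‖ := by rw [norm_mul, norm_neg, Complex.norm_I, one_mul]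
    _ ≤ R + ‖(δ : ℂ) / 2‖ := by gcongr

/-- **The face domain of a bounded domain is bounded.** [folklore] -/
theorem isBounded_faceDomain {Ω : Set ℂ} (hΩ : Bornology.IsBounded Ω) (δ : ℝ) (a : MidEdge) :
    Bornology.IsBounded (faceDomain Ω δ a) := by
  unfold faceDomain
  exact isBounded_image_gmSimilarity_symm δ
    ((hΩ.subset (faceUnion_meshFaces_subset Ω δ a)).subset interior_subset)

/-! ### The two boundary vertices are joined in the discretised face domain -/

/-- The rhombi of `Δ` resting on two distinct boundary edges joined by a Yang–Baxter walk of `Δ`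
are joined by a chain of side-adjacent rhombi of `Δ`. [folklore] -/
theorem faceAdj_reachable_inclFace {Δ : Set Face} {a b : MidEdge} (hab : a ≠ b)
    (ha : IsBdryEdge Δ a) (hb : IsBdryEdge Δ b) (γ : YBWalk Δ a b) :
    (faceAdj Δ).Reachable (inclFace Δ a) (inclFace Δ b) := by
  have h0 := YBWalk.arcs_length_pos γ hab
  have h := reachable_fc ha γ (k := γ.arcs.length - 1) (by omega)
  rwa [(fc_last_eq hb hab γ).1] at h

/-- Reachability in the mesh vertex graph of the face domain gives reachability in its canonical
hexagonal discretisation (the discrete domain is the whole mesh vertex set). [folklore] -/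
theorem hexDomainGraph_reachable_of_embMeshVertexGraph (Ω : Set ℂ) {δ : ℝ} (hδ : δ ≠ 0)
    (a : MidEdge) {x y : embMeshVertices hexCenter (faceDomain Ω δ a) δ}
    (h : (embMeshVertexGraph hexGraph hexCenter (faceDomain Ω δ a) δ).Reachable x y) :
    (hexDomainGraph (faceDomain Ω δ a) δ).Reachable x.1 y.1 := by
  have hD := embMeshDomain_faceDomain_eq Ω hδ a
  let φ : embMeshVertexGraph hexGraph hexCenter (faceDomain Ω δ a) δ →g
      hexDomainGraph (faceDomain Ω δ a) δ :=
    { toFun := Subtype.val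
      map_rel' := fun {u v} huv =>
        (embDomainGraph_adj_iff hexGraph hexCenter).2
          ⟨huv, by rw [hD]; exact u.2, by rw [hD]; exact v.2⟩ }
  exact h.map φ

/-- **The boundary vertices of two distinct boundary edges of `Ω_δ` joined by a Yang–Baxter walk are
joined in the canonical hexagonal discretisation of the face domain.** [folklore] -/
theorem hexDomainGraph_reachable_bdryVertex {Ω : Set ℂ} {δ : ℝ} (hδ : δ ≠ 0) {a b : MidEdge}
    (hab : a ≠ b) (ha : IsBdryEdge (meshFaces third Ω δ) a) (hb : IsBdryEdge (meshFaces third Ω δ) b)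
    (γ : YangBaxterSAW third Ω δ a b) :
    (hexDomainGraph (faceDomain Ω δ a) δ).Reachable (bdryVertex (meshFaces third Ω δ) a)
      (bdryVertex (meshFaces third Ω δ) b) := by
  obtain ⟨p⟩ := faceAdj_reachable_inclFace hab ha hb γ
  have ha' : inclFace (meshFaces third Ω δ) a ∈ faceComp (meshFaces third Ω δ) a :=
    ⟨ha.inclFace_spec.1, SimpleGraph.Reachable.refl _⟩
  obtain ⟨_, _, h⟩ := embMeshVertexGraph_reachable_of_walk Ω hδ a p ha'
    (gmFace_bdryVertex (meshFaces third Ω δ) a) (gmFace_bdryVertex (meshFaces third Ω δ) b)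
  exact hexDomainGraph_reachable_of_embMeshVertexGraph Ω hδ a h

end FaceLawHonest

open FaceLawHonest

/-! ### The face law is honest -/

/-- **The face-domain hexagonal law is a probability measure.** For a bounded domain `Ω`, a mesh
`δ > 0` and distinct boundary mid-edges `a ≠ b` of `Ω_δ = meshFaces (π/3) Ω δ` joined by a
Glazman–Manolescu walk of `Ω_δ`, the critical hexagonal SAW law of the face domain `faceDomain Ω δ a`
between the boundary vertices of `a` and `b` is a probability measure (the face domain is bounded
and the two vertices are joined in its discretisation, along the rhombi of the walk). [folklore] -/
theorem isProbabilityMeasure_hexSAWLaw_faceDomain : ∀ (Ω : Set ℂ), Bornology.IsBounded Ω → ∀ (δ : ℝ), 0 < δ → ∀ a b : MidEdge, a ≠ b → IsBdryEdge (meshFaces third Ω δ) a → IsBdryEdge (meshFaces third Ω δ) b → Nonempty (YangBaxterSAW third Ω δ a b) → IsProbabilityMeasure (hexSAWLaw (faceDomain Ω δ a) δ (bdryVertex (meshFaces third Ω δ) a) (bdryVertex (meshFaces third Ω δ) b)) := by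
  intro Ω hΩ δ hδ a b hab ha hb hγ
  obtain ⟨γ⟩ := hγ
  exact isProbabilityMeasure_hexSAWLaw_of_reachable (isBounded_faceDomain hΩ δ a) hδ.ne'
    (hexDomainGraph_reachable_bdryVertex hδ.ne' hab ha hb γ)

/-- **Eventual form in the rotated, half-shifted domains `S_δ(D) = σD − iδ/2`.** If, for all small
`δ > 0`, `a' δ ≠ b' δ` are boundary edges of `(S_δ D)_δ` joined by a Glazman–Manolescu walk, then for
all small `δ > 0` the hexagonal law of the face domain of `S_δ(D)` at `a' δ`, between the boundary
vertices of `a' δ` and `b' δ`, is a probability measure. [folklore] -/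
theorem eventually_isProbabilityMeasure_faceLaw : ∀ (D : DobrushinDomain) (a' b' : ℝ → MidEdge), (∀ᶠ δ in 𝓝[>] (0 : ℝ), a' δ ≠ b' δ ∧ IsBdryEdge (meshFaces third (((D.map (similarity I I_ne_zero 0)).map (similarity 1 one_ne_zero (-(I * (δ : ℂ) / 2)))).carrier) δ) (a' δ) ∧ IsBdryEdge (meshFaces third (((D.map (similarity I I_ne_zero 0)).map (similarity 1 one_ne_zero (-(I * (δ : ℂ) / 2)))).carrier) δ) (b' δ) ∧ Nonempty (YangBaxterSAW third (((D.map (similarity I I_ne_zero 0)).map (similarity 1 one_ne_zero (-(I * (δ : ℂ) / 2)))).carrier) δ (a' δ) (b' δ))) → ∀ᶠ δ : ℝ in 𝓝[>] (0 : ℝ), IsProbabilityMeasure (hexSAWLaw (faceDomain (((D.map (similarity I I_ne_zero 0)).map (similarity 1 one_ne_zero (-(I * (δ : ℂ) / 2)))).carrier) δ (a' δ)) δ (bdryVertex (meshFaces third (((D.map (similarity I I_ne_zero 0)).map (similarity 1 one_ne_zero (-(I * (δ : ℂ) / 2)))).carrier) δ) (a' δ)) (bdryVertex (meshFaces third (((D.map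 (similarity I I_ne_zero 0)).map (similarity 1 one_ne_zero (-(I * (δ : ℂ) / 2)))).carrier) δ) (b' δ))) := by
  intro D a' b' h
  filter_upwards [h, self_mem_nhdsWithin] with δ hδe hδ
  exact isProbabilityMeasure_hexSAWLaw_faceDomain _
    ((D.map (similarity I I_ne_zero 0)).map (similarity 1 one_ne_zero (-(I * (δ : ℂ) / 2)))).isBounded
    δ hδ (a' δ) (b' δ) hδe.1 hδe.2.1 hδe.2.2.1 hδe.2.2.2

/-- **The critical Yang–Baxter law of `Ω_δ` at `Θ ≡ π/3` is a probability measure** under the same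
hypotheses: it is the push-forward of the face-domain hexagonal law along the dictionary map
`hexToYB` (`map_hexSAWLaw_eq_ybLaw`). [folklore] -/
theorem isProbabilityMeasure_ybLaw_third : ∀ (Ω : Set ℂ), Bornology.IsBounded Ω → ∀ (δ : ℝ), 0 < δ → ∀ a b : MidEdge, a ≠ b → IsBdryEdge (meshFaces third Ω δ) a → IsBdryEdge (meshFaces third Ω δ) b → Nonempty (YangBaxterSAW third Ω δ a b) → IsProbabilityMeasure (ybLaw third Ω δ 1 a b) := by
  intro Ω hΩ δ hδ a b hab ha hb hγ
  haveI := isProbabilityMeasure_hexSAWLaw_faceDomain Ω hΩ δ hδ a b hab ha hb hγ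
  rw [← map_hexSAWLaw_eq_ybLaw hδ.ne' ha hb hab]
  exact Measure.isProbabilityMeasure_map (EmbDomainSAW.measurable_of_top _).aemeasurable

end Summit.CriticalPhenomena.SAWScalingLimit.Cruxes.LatticeUniversality.Birth

end
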